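import Summits.Parity.GeneralizedHardyLittlewood.Theorems.FordMaynardNoSieveConst0164NegWitness0164DefsTable

/-!
# Route `FordMaynardNoSieveConst0164`, crux `NegWitness0164` (stmt-Parity-19102), line `birth`,
# stub `stub_tweakNeg0164`: enclosure layer — support constraints of the certified table

Helper file toward the certificate stub (K. Ford, J. Maynard, *On the theory of prime producing sieves*,
arXiv:2407.14368, §8).  For the LINK step of the α-families (bounding `Σ_τ lpCoeff0164(τ,j₀,j₁)·F_τ(α)` by the
piece polynomials, see this hand's census on stmt-Parity-19102) one needs a cheap superset of the support of
`τ ↦ lpCoeff0164(τ, j₀, j₁)`.  Every one of the 97 listed tuples has index sum in `[8, 12]` (admissibility of the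
cell: `Σ e_c < 1 < Σ e_{c+1}`), and the pair-edge condition bounds every index pair by `10`; hence a nonzero
`lpCoeff0164(τ,j₀,j₁)` forces `8 ≤ Στ + j₀ + j₁ ≤ 12` and `τ_k + j_m ≤ 10`.

* `lpTable0164_eq_zero_of_not_sum`, `lpTable0164_sum_range`, `lpCoeff0164_sum_range`;
* `lpCoeff0164_append_sum_range`, `lpCoeff0164_append_index_le` — the family form.

Def-free.  References: [FordMaynard2024PrimeSieves] arXiv:2407.14368, §8; the certificate fspec_41_250_m24 (item evidence).
-/

noncomputable section

open Finset MeasureTheory Set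
open scoped Classical
open Literature.NumberTheory.Sieve Literature.NumberTheory.Sieve.FordMaynard

namespace Summit.Parity.GeneralizedHardyLittlewood.FordMaynardNoSieveConst0164NegWitness0164

/-- Off the tuples with index sum in `[8, 12]` the table vanishes (all 97 listed tuples have such sums). [folklore] -/
theorem lpTable0164_eq_zero_of_not_sum (u : Fin 5 → Fin 24)
    (hP : ¬ (8 ≤ ∑ k, (u k : ℕ) ∧ ∑ k, (u k : ℕ) ≤ 12)) : lpTable0164 u = 0 := by
  unfold lpTable0164
  repeat' rw [if_neg (by rintro rfl; exact hP (by decide))]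

/-- **A nonzero table entry has index sum in `[8, 12]`.** [folklore] -/
theorem lpTable0164_sum_range (u : Fin 5 → Fin 24) (h : lpTable0164 u ≠ 0) :
    8 ≤ ∑ k, (u k : ℕ) ∧ ∑ k, (u k : ℕ) ≤ 12 := by
  by_contra hP
  exact h (lpTable0164_eq_zero_of_not_sum u hP)

/-- **A nonzero `lpCoeff0164 t` has index sum in `[8, 12]`** (the sum is invariant under sorting). [folklore] -/
theorem lpCoeff0164_sum_range (t : Fin 5 → Fin 24) (h : lpCoeff0164 t ≠ 0) :
    8 ≤ ∑ k, (t k : ℕ) ∧ ∑ k, (t k : ℕ) ≤ 12 := by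
  unfold lpCoeff0164 at h
  have hr := lpTable0164_sum_range _ h
  have hsum : ∑ k, ((t ∘ ⇑(Tuple.sort t)) k : ℕ) = ∑ k, (t k : ℕ) :=
    Equiv.sum_comp (Tuple.sort t) (fun k => (t k : ℕ))
  rw [hsum] at hr
  exact hr

/-- **Family form of the sum constraint**: if `lpCoeff0164 (τ, j) ≠ 0` for `τ : Fin 3 → Fin 24`, `j : Fin 2 → Fin 24`,
then `8 ≤ Στ + Σj ≤ 12`. [folklore] -/
theorem lpCoeff0164_append_sum_range (τ : Fin 3 → Fin 24) (j : Fin 2 → Fin 24)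
    (h : lpCoeff0164 (Fin.append τ j) ≠ 0) :
    8 ≤ ∑ k, (τ k : ℕ) + ∑ k, (j k : ℕ) ∧ ∑ k, (τ k : ℕ) + ∑ k, (j k : ℕ) ≤ 12 := by
  have hr := lpCoeff0164_sum_range _ h
  have hsplit : ∑ k : Fin (3 + 2), ((Fin.append τ j k : Fin 24) : ℕ) = ∑ k, (τ k : ℕ) + ∑ k, (j k : ℕ) := by
    rw [Fin.sum_univ_add]
    simp only [Fin.append_left, Fin.append_right]
  rw [hsplit] at hr
  exact hr

/-- **Family form of the pair-edge condition**: if `lpCoeff0164 (τ, j) ≠ 0` then `τ_k + j_m ≤ 10` for all `k, m`.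
[cite: FordMaynard2024PrimeSieves, §8 (support of f_{5,0} inside {x₄ + x₅ < 1/2})] -/
theorem lpCoeff0164_append_index_le (τ : Fin 3 → Fin 24) (j : Fin 2 → Fin 24)
    (h : lpCoeff0164 (Fin.append τ j) ≠ 0) (k : Fin 3) (m : Fin 2) : (τ k : ℕ) + (j m : ℕ) ≤ 10 := by
  have hne : (Fin.castAdd 2 k : Fin (3 + 2)) ≠ Fin.natAdd 3 m := by
    intro e
    have := congrArg Fin.val e
    simp only [Fin.val_castAdd, Fin.val_natAdd] at this
    omega
  have hp := lpCoeff0164_pair (Fin.append τ j) h (Fin.castAdd 2 k) (Fin.natAdd 3 m) hne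
  rw [Fin.append_left, Fin.append_right] at hp
  have hcast : ((τ k : ℕ) : ℝ) + ((j m : ℕ) : ℝ) < 11 := by nlinarith
  have hnat : (τ k : ℕ) + (j m : ℕ) < 11 := by exact_mod_cast hcast
  omega

end Summit.Parity.GeneralizedHardyLittlewood.FordMaynardNoSieveConst0164NegWitness0164

end
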